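import Summits.BirchSwinnertonDyer.BirchSwinnertonDyer.Theorems.CMKolyvaginAtInertTwoShaCountAtTwo
import Summits.BirchSwinnertonDyer.BirchSwinnertonDyer.Theorems.CMKolyvaginAtInertTwoShaCountJacobiHeegnerAtTwo
import Summits.BirchSwinnertonDyer.BirchSwinnertonDyer.Theorems.CMKolyvaginAtInertTwoShaCountRankFiniteAtTwo
import Literature.NumberTheory.EllipticCurves.TwoTorsionOddDegreeBaseChangeProofs
import HarnessLib

/-!
# Route `CMKolyvaginAtInertTwo`, crux `CMKolyvaginExactAtInertTwo` (stmt-BirchSwinnertonDyer-24277):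
# THE COUNT IDENTITY, XI — GENERAL FORM on a prime Heegner field, BOTH signs of `Δ`, no CM:
# `ord₂ #Ш(E_K) = ord₂ #Ш(E) + ord₂ #Ш(E^{(d_K)}) + 2·[Δ_E > 0 ∧ a_q(E) even]`

Seat `bsd-line-cmk2-p1` g15 (cell `bsd-print-cf2`); helper (`--supports stmt-BirchSwinnertonDyer-24277`).
THEOREMS ONLY: no definition, no named fact, no `sorry`; Milne / GZ / GZK / modularity are HYPOTHESES;
no item is closed; BSD is not proved by this.

Files IV/IX state the identity on `Δ < 0` (the habitat of this route). The sibling route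
`GenusKolyvaginAtTwo` (gk2) has cruxes on BOTH `Δ < 0` (`…R`) and `Δ > 0` (`…T`) habitats whose
conclusions are about `#Ш(E/K)[2^∞]` while their engines run over `ℚ`; they need the same bridge.
With the archimedean factor `n_E = #π₀(E(ℝ)) ∈ {1, 2}` kept symbolic, Milne's identity reads
`n_E·#Ш(E)·#Ш(E_d)·∏c(E)·∏c(E_d)·#E(K)_t² = #Ш(E_K)·∏c(E_K)·#E_t²·#E_{d,t}²·2`, and with
`(Δ/q) = sign Δ` (file X): **`ord₂ #Ш(E_K) = ord₂ #Ш(E) + ord₂ #Ш(E_d) + 2·[Δ > 0 ∧ a_q even]`** —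
on `Δ < 0` the product formula, on `Δ > 0` an extra factor `4` exactly when `Ẽ(𝔽_q)` has full
`2`-torsion (`c_q(E_d) = 4`).

* `natIdentity_of_milne_general` — the identity of naturals with `n_E` symbolic;
* `padicValNat_two_shaOrder_baseChange_eq_of_milne_general` — the `ord₂` identity above;
* `card_primaryComponent_sha_two_baseChange_eq_of_heegnerData_of_facts_general` — for ANY globally
  minimal `W/ℚ` with `ρ̄_{E,2}` onto, prime Heegner field, `y_K = P(1)` non-torsion, modulo GZ/GZK/
  modularity/Milne: `#Ш(E_K)[2^∞] = #Ш(E)[2^∞]·#Ш(E^{(d_K)})[2^∞]·(4 if Δ > 0 ∧ a_q even, else 1)`.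

References: Milne 1972 §1; Kramer 1981 Prop. 3; Gross–Zagier 1986; Gross 1991 §§1–2.
-/

-- single-conjunct summit: `Summit.BirchSwinnertonDyer.BirchSwinnertonDyer.…` repeats the name by design
set_option linter.dupNamespace false
set_option autoImplicit false

noncomputable section

open scoped Classical

open WeierstrassCurve NumberField Literature.NumberTheory.EllipticCurves
  Literature.NumberTheory.EllipticCurves.ModularForms Literature.NumberTheory.QuadraticFields
  Summit.BirchSwinnertonDyer.Rank1Residual.AdditivePotMult

namespace Summit.BirchSwinnertonDyer.BirchSwinnertonDyer.Theorems.ShaCountTwo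

section General

variable (W : WeierstrassCurve ℚ) [W.IsElliptic] [W.IsGloballyMinimal]
  (K : Type) [Field K] [NumberField K] (hK : IsImaginaryQuadratic K)
  (hodd : Odd (NumberField.discr K)) (hH : SatisfiesHeegnerHypothesis (W.conductorNorm ℤ) K)
  (Wd : WeierstrassCurve ℚ) [Wd.IsElliptic] [Wd.IsGloballyMinimal] (Cd : VariableChange ℚ)
  (hWd : Cd • W.quadraticTwist (NumberField.discr K : ℚ) = Wd) (hu : |(Cd.u : ℚ)| = 1)
  (hr : W.mordellWeilRank + Wd.mordellWeilRank = 1)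
  (h2t : ∀ P : (W.baseChange K).toAffine.Point, (2 : ℕ) • P = 0 → P = 0)

include hK hH hWd hu hr h2t in
/-- **Milne's identity as naturals with the archimedean factor kept**:
`n_E·#Ш(E)·#Ш(E_d)·∏c(E)·∏c(E_d)·#E(K)_t² = #Ш(E_K)·∏c(E_K)·#E_t²·#E_{d,t}²·2`, `n_E = #π₀(E(ℝ))`
(file IV's `natIdentity_of_milne` without `Δ < 0`). [cite: Milne1972ArithmeticAV, §1 Thm. 1 and §2 (through DokchitserDokchitserAnnals2010, §2.1, proof of Thm. 2.3)]
[cite: GrossZagier1986, V.§2 (p. 311)] -/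
theorem natIdentity_of_milne_general (hMilneC : Milne1972.bsdQuotient_baseChange_quadratic_anyModel)
    [Finite W.sha] [Finite Wd.sha] :
    Finite (W.baseChange K).sha ∧
      (W.baseChange ℝ).numRealComponents * W.shaOrder * Wd.shaOrder * W.tamagawaProduct *
          Wd.tamagawaProduct * (W.baseChange K).torsionOrder ^ 2 =
        (W.baseChange K).shaOrder * (W.baseChange K).tamagawaProduct *
          W.torsionOrder ^ 2 * Wd.torsionOrder ^ 2 * 2 := by
  have h2 : Module.finrank ℚ K = 2 := hK.1
  haveI : IsTotallyComplex K := hK.2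
  haveI hEK : (W.baseChange K).IsElliptic := by rw [baseChange]; infer_instance
  have hV : ∃ C : VariableChange K, C • W.baseChange K = W.baseChange K := ⟨1, one_smul _ _⟩
  -- Milne on the canonical model
  obtain ⟨hshaK, hWR⟩ := hMilneC W K h2 Wd ⟨Cd, hWd⟩ (W.baseChange K) hV ‹Finite W.sha› ‹Finite Wd.sha›
  haveI : Finite (W.baseChange K).sha := hshaK
  refine ⟨hshaK, ?_⟩
  have hmod := modifiedTamagawaProduct_baseChange_eq_tamagawaProduct_of_satisfiesHeegnerHypothesis W K
    h2 hH
  rw [hmod, Rat.cast_natCast] at hWR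
  -- the archimedean and regulator factors
  have hA := realPeriod_mul_realPeriod_quadraticTwist_eq_mul_bsdPeriod W K h2
  have hoddV : Odd (W.baseChange K).torsionOrder :=
    odd_torsionOrder_model_of_forall_two_nsmul_baseChange W K (W.baseChange K) hV h2t
  have hreg : (W.baseChange K).regulator = 2 * W.regulator * Wd.regulator :=
    regulator_baseChange_quadratic_eq_two_mul_of_rank_add_eq_one_of_odd W K h2 Wd ⟨Cd, hWd⟩
      (W.baseChange K) hV hr hoddV
  have hm : ((1 : ℕ) : ℝ) * (W.baseChange K).regulator = ((2 : ℕ) : ℝ) * (W.regulator * Wd.regulator) := by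
    rw [hreg]; push_cast; ring
  have key := milneQuotient_mul_eq_of_arch_of_regulator_gen W K Wd (W.baseChange K) hWd (C' := 1)
    (one_smul _ _) hA hm
  -- `Q(V) = R ≠ 0`, so `X = Y`
  have hR0 : W.bsdRHS * Wd.bsdRHS ≠ 0 :=
    mul_ne_zero (W.bsdRHS_ne_zero ‹Finite W.sha›) (Wd.bsdRHS_ne_zero ‹Finite Wd.sha›)
  rw [hWR] at key
  have hXY := mul_left_cancel₀ hR0 (key.trans (mul_comm _ _))
  -- read off the units: `|u_d| = 1`, `|N(u')| = 1`
  have hnorm : |Algebra.norm ℚ (((1 : VariableChange K).u : Kˣ) : K)| = 1 := by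
    rw [show (((1 : VariableChange K).u : Kˣ) : K) = 1 from rfl, map_one, abs_one]
  rw [hu, hnorm] at hXY
  have hXYℚ : ((W.baseChange ℝ).numRealComponents * (1 : ℚ) * W.shaOrder * Wd.shaOrder *
      W.tamagawaProduct * Wd.tamagawaProduct * (W.baseChange K).torsionOrder ^ 2 * (1 : ℕ) : ℚ) =
      (1 * (W.baseChange K).shaOrder * (W.baseChange K).tamagawaProduct *
        W.torsionOrder ^ 2 * Wd.torsionOrder ^ 2 * (2 : ℕ) : ℚ) := by
    exact_mod_cast hXY
  have hXYℕ : (((W.baseChange ℝ).numRealComponents * W.shaOrder * Wd.shaOrder * W.tamagawaProduct *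
      Wd.tamagawaProduct * (W.baseChange K).torsionOrder ^ 2 : ℕ) : ℚ) =
      (((W.baseChange K).shaOrder * (W.baseChange K).tamagawaProduct *
        W.torsionOrder ^ 2 * Wd.torsionOrder ^ 2 * 2 : ℕ) : ℚ) := by
    push_cast at hXYℚ ⊢
    linear_combination hXYℚ
  exact_mod_cast hXYℕ


include hK hodd hH hWd hu hr h2t in
/-- **`ord₂ #Ш(E_K) = ord₂ #Ш(E) + ord₂ #Ш(E_d) + 2·[Δ > 0 ∧ a_q(E) even]`** on a prime Heegner field
`ℚ(√−q)` (modulo Milne): `ord₂ n_E = [Δ > 0]`, `∏c(E_K) = (∏c(E))²` (IIIa), `#E(K)_t = #E_t·#E_{d,t}`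
(II), `ord₂ ∏c(E_d) = ord₂ ∏c(E) + [(Δ/q) = −1] + 2[(Δ/q) = 1 ∧ a_q even]` (IIIb) and
`(Δ/q) = sign Δ` (X). [cite: Kramer1981, Prop. 3] [cite: Milne1972ArithmeticAV, §1 Thm. 1] -/
theorem padicValNat_two_shaOrder_baseChange_eq_of_milne_general
    (hMilneC : Milne1972.bsdQuotient_baseChange_quadratic_anyModel)
    (hq : (NumberField.discr K).natAbs.Prime) [Finite W.sha] [Finite Wd.sha] :
    Finite (W.baseChange K).sha ∧
      padicValNat 2 (W.baseChange K).shaOrder = padicValNat 2 W.shaOrder + padicValNat 2 Wd.shaOrder +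
        (if 0 < W.Δ ∧ Even (W.frobeniusTrace (NumberField.discr K).natAbs) then 2 else 0) := by
  haveI : Fact (Nat.Prime 2) := ⟨Nat.prime_two⟩
  have h2 : Module.finrank ℚ K = 2 := hK.1
  haveI hEK : (W.baseChange K).IsElliptic := by rw [baseChange]; infer_instance
  obtain ⟨hshaK, hid⟩ := natIdentity_of_milne_general W K hK hH Wd Cd hWd hu hr h2t hMilneC
  haveI : Finite (W.baseChange K).sha := hshaK
  refine ⟨hshaK, ?_⟩
  have hV : ∃ C : VariableChange K, C • W.baseChange K = W.baseChange K := ⟨1, one_smul _ _⟩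
  have hTK : (W.baseChange K).tamagawaProduct = W.tamagawaProduct ^ 2 :=
    tamagawaProduct_baseChange_eq_sq_of_heegner W K h2 hH
  have hTd := padicValNat_two_tamagawaProduct_twist_of_heegner_of_prime_discr W K hK hodd hH Cd hWd hq
  have hjac := jacobiSym_minimalDiscriminantInt_natAbs_discr W K hK hodd hH hq
  have hnum : W.Δ.num = minimalDiscriminantInt W := by
    rw [← cast_minimalDiscriminantInt W, Rat.num_intCast]
  rw [hnum, hjac] at hTd
  have htor : (W.baseChange K).torsionOrder = W.torsionOrder * Wd.torsionOrder :=
    torsionOrder_baseChange_quadratic_eq_mul_of_forall_two_nsmul W K h2 Wd ⟨Cd, hWd⟩ (W.baseChange K)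
      hV h2t
  have hnR : (W.baseChange ℝ).numRealComponents = if 0 < W.Δ then 2 else 1 :=
    numRealComponents_baseChange_real W
  have hΔ0 : W.Δ ≠ 0 := by rw [← coe_Δ']; exact W.Δ'.ne_zero
  -- evaluate the archimedean factor `nR` and the twist's Tamagawa defect `J` by the sign of `Δ`
  obtain ⟨nR, J, hnRv, hTd', hgoal⟩ : ∃ nR J : ℕ, (W.baseChange ℝ).numRealComponents = nR ∧
      padicValNat 2 Wd.tamagawaProduct = padicValNat 2 W.tamagawaProduct + J ∧
      padicValNat 2 nR + J =
        1 + (if 0 < W.Δ ∧ Even (W.frobeniusTrace (NumberField.discr K).natAbs) then 2 else 0) := by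
    by_cases hpos : 0 < W.Δ
    · have hneg : ¬ W.Δ < 0 := not_lt.mpr hpos.le
      rw [if_neg hneg] at hTd
      by_cases hev : Even (W.frobeniusTrace (NumberField.discr K).natAbs)
      · refine ⟨2, 2, by rw [hnR, if_pos hpos], ?_, ?_⟩
        · rw [hTd]; norm_num [hev]
        · rw [padicValNat_self, if_pos ⟨hpos, hev⟩]
      · refine ⟨2, 0, by rw [hnR, if_pos hpos], ?_, ?_⟩
        · rw [hTd]; norm_num [hev]
        · rw [padicValNat_self, if_neg (fun h ↦ hev h.2)]
    · have hneg : W.Δ < 0 := lt_of_le_of_ne (not_lt.mp hpos) hΔ0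
      rw [if_pos hneg] at hTd
      refine ⟨1, 1, by rw [hnR, if_neg hpos], ?_, ?_⟩
      · rw [hTd]; norm_num
      · rw [padicValNat_one_right, if_neg (fun h ↦ hpos h.1)]
  have hnR0 : nR ≠ 0 := by rw [← hnRv]; exact (W.baseChange ℝ).numRealComponents_pos.ne'
  -- non-vanishing
  have hS0 : W.shaOrder ≠ 0 := (W.shaOrder_pos ‹Finite W.sha›).ne'
  have hSd0 : Wd.shaOrder ≠ 0 := (Wd.shaOrder_pos ‹Finite Wd.sha›).ne'
  have hSK0 : (W.baseChange K).shaOrder ≠ 0 := ((W.baseChange K).shaOrder_pos hshaK).ne'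
  have hT0 : W.tamagawaProduct ≠ 0 := W.tamagawaProduct_pos'.ne'
  have hTd0 : Wd.tamagawaProduct ≠ 0 := Wd.tamagawaProduct_pos'.ne'
  have ht0 : W.torsionOrder ≠ 0 := W.torsionOrder_pos_holds.ne'
  have htd0 : Wd.torsionOrder ≠ 0 := Wd.torsionOrder_pos_holds.ne'
  rw [hTK, htor, hnRv] at hid
  have hv := congrArg (padicValNat 2) hid
  rw [padicValNat.mul (mul_ne_zero (mul_ne_zero (mul_ne_zero (mul_ne_zero hnR0 hS0) hSd0) hT0) hTd0)
        (pow_ne_zero 2 (mul_ne_zero ht0 htd0)),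
    padicValNat.mul (mul_ne_zero (mul_ne_zero (mul_ne_zero hnR0 hS0) hSd0) hT0) hTd0,
    padicValNat.mul (mul_ne_zero (mul_ne_zero hnR0 hS0) hSd0) hT0,
    padicValNat.mul (mul_ne_zero hnR0 hS0) hSd0, padicValNat.mul hnR0 hS0,
    padicValNat.mul (mul_ne_zero (mul_ne_zero (mul_ne_zero hSK0 (pow_ne_zero 2 hT0))
        (pow_ne_zero 2 ht0)) (pow_ne_zero 2 htd0)) two_ne_zero,
    padicValNat.mul (mul_ne_zero (mul_ne_zero hSK0 (pow_ne_zero 2 hT0)) (pow_ne_zero 2 ht0))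
      (pow_ne_zero 2 htd0),
    padicValNat.mul (mul_ne_zero hSK0 (pow_ne_zero 2 hT0)) (pow_ne_zero 2 ht0),
    padicValNat.mul hSK0 (pow_ne_zero 2 hT0), padicValNat.pow, padicValNat.pow, padicValNat.pow,
    padicValNat.pow, padicValNat.mul ht0 htd0, hTd', padicValNat_self] at hv
  omega

end General

/-! ## The general capstone for the crux-style binders (no CM) -/

/-- **GENERAL COUNT IDENTITY for a prime Heegner field, both signs of `Δ`, modulo the published
inputs** (Gross–Zagier all levels, GZK, modularity, Milne any-model). `W/ℚ` globally minimal with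
`ρ̄_{E,2}` onto; `K` imaginary quadratic, `d_K` odd, `|d_K| = q` prime, Heegner hypothesis for `N(W)`;
`Dt` a parametrisation datum, `d₁` Kolyvagin–Heegner data of conductor `1` with `P(1)` non-torsion.
THEN `Ш(E_K)` is finite and
**`#Ш(E_K)[2^∞] = #Ш(E)[2^∞] · #Ш(E^{(d_K)})[2^∞] · (4 if 0 < Δ ∧ a_q(E) even, else 1)`**.
On gk2's `R`-habitats (`Δ < 0`) this is the product formula; on its `T`-habitats (`Δ > 0`) the
factor `4^{[a_q even]}` must be carried. [cite: Milne1972ArithmeticAV, §1 Thm. 1 and §2 (through DokchitserDokchitserAnnals2010, §2.1, proof of Thm. 2.3)]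
[cite: Kramer1981, Prop. 3] [cite: GrossZagier1986, Thm. I.(6.3) with V.§2] -/
theorem card_primaryComponent_sha_two_baseChange_eq_of_heegnerData_of_facts_general
    (hGZ : ∀ (N : ℕ) [NeZero N] (W : WeierstrassCurve ℚ) (K : Type) [Field K] [NumberField K],
      gross_zagier N W K)
    (hGZK : rank_eq_analyticRank_of_analyticRank_le_one) (hmod : hasEntireLFunction_rat)
    (hMilneC : Milne1972.bsdQuotient_baseChange_quadratic_anyModel)
    (W : WeierstrassCurve ℚ) [W.IsElliptic] [W.IsGloballyMinimal] [NeZero (W.conductorNorm ℤ)]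
    (hsurj : W.HasSurjectiveModNGaloisRep 2)
    (K : Type) [Field K] [NumberField K] (hK : IsImaginaryQuadratic K)
    (hodd : Odd (NumberField.discr K)) (hH : SatisfiesHeegnerHypothesis (W.conductorNorm ℤ) K)
    (hq : (NumberField.discr K).natAbs.Prime)
    (Dt : ModularParametrizationData W (W.conductorNorm ℤ)) (β : ℤ) (ι : K →+* ℂ)
    (d₁ : KolyvaginHeegnerData Dt β ι 1) (hy : ¬ IsOfFinAddOrder d₁.derivedPoint) :
    Finite (W.baseChange K).sha ∧
      Nat.card (AddCommGroup.primaryComponent (W.baseChange K).sha 2) =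
        Nat.card (AddCommGroup.primaryComponent W.sha 2) *
          Nat.card (AddCommGroup.primaryComponent (W.quadraticTwist (NumberField.discr K : ℚ)).sha 2) *
          (if 0 < W.Δ ∧ Even (W.frobeniusTrace (NumberField.discr K).natAbs) then 4 else 1) := by
  haveI : Fact (Nat.Prime 2) := ⟨Nat.prime_two⟩
  obtain ⟨Wd, Cd, hWd, hu, hEd, hmin⟩ :=
    exists_isGloballyMinimal_twist_of_prime_discr W K hK hodd hH hq
  haveI : Wd.IsElliptic := hEd
  haveI : Wd.IsGloballyMinimal := hmin
  obtain ⟨hr, hfinW, hfinD⟩ := rank_add_eq_one_and_finite_sha_of_heegnerData_of_facts hGZ hGZK hmod W K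
    hK hH Dt β ι d₁ hy Wd ⟨Cd, hWd⟩
  haveI : Finite W.sha := hfinW
  haveI : Finite Wd.sha := hfinD
  have h2t : ∀ P : (W.baseChange K).toAffine.Point, (2 : ℕ) • P = 0 → P = 0 :=
    forall_two_nsmul_baseChange_of_hasSurjectiveModNGaloisRep_two_of_isImaginaryQuadratic W hsurj K hK
  obtain ⟨hshaK, hv⟩ := padicValNat_two_shaOrder_baseChange_eq_of_milne_general W K hK hodd hH Wd Cd
    hWd hu hr h2t hMilneC hq
  haveI : Finite (W.baseChange K).sha := hshaK
  refine ⟨hshaK, ?_⟩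
  have hv' : padicValNat 2 (Nat.card (W.baseChange K).sha) =
      padicValNat 2 (Nat.card W.sha) + padicValNat 2 (Nat.card Wd.sha) +
        (if 0 < W.Δ ∧ Even (W.frobeniusTrace (NumberField.discr K).natAbs) then 2 else 0) := hv
  rw [← card_primaryComponent_sha_variableChange (W.quadraticTwist (NumberField.discr K : ℚ)) Cd, hWd,
    natCard_primaryComponent_eq_pow_padicValNat 2, natCard_primaryComponent_eq_pow_padicValNat 2,
    natCard_primaryComponent_eq_pow_padicValNat 2, hv']
  by_cases h : 0 < W.Δ ∧ Even (W.frobeniusTrace (NumberField.discr K).natAbs)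
  · rw [if_pos h, if_pos h, pow_add, pow_add]
    norm_num
  · rw [if_neg h, if_neg h, add_zero, pow_add, mul_one]

end Summit.BirchSwinnertonDyer.BirchSwinnertonDyer.Theorems.ShaCountTwo

end
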